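import Summits.ResolutionOfSingularities.ResolutionOfSingularities.Theorems.FrobeniusLadderFInjectiveMacaulayficationFanCheckSoundBinders
import HarnessLib

/-!
# Fan-check kit, MULTI-VERTEX cover records in list currency: `checkHcovMulti` and its soundness `hcov_of_checkMulti`
# (crux `FInjectiveMacaulayfication` stmt-ResolutionOfSingularities-15315, chain w45a; (W-TD) BED D storey 1 (D-1), res-L1-w45a-plan-1 R21.18 (4); seat res-L1-w45a-stub-2 g10)

[OURS · L1 W4.5a] Support file (`--supports stmt-ResolutionOfSingularities-15315 --as helper`); generic glue for the road-B data kit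
`FanCheckKit` / `FanCheckSound` (res-L1-w45a-stub-4); NOT a statement of any manuscript; AI-written (AI review is weaker than expert review).

WHY. On a product centre `𝔪·K` whose fan has hundreds of charts and ~10⁴ generators (BED D storey 1: 327 charts, 9835 generators), most
generators `x^a` are NOT divisible by a single chart vertex and the single-vertex cover records of `FanCheckKit.checkHcov`
(`K•a = m_c + (K-1)•b + r`) do not exist; what exists is a CONVEX record `K•a = Σ_i cnt_i • m_{c_i} + r` over a few chart vertices
(`MonomialCoverMultiRecord`, res-L1-w45a-lead-1). The dense form `cnt : Fin t → ℕ` costs `t·n` per record in the kernel; this file gives the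
SPARSE list form: a record is `([(c₀,cnt₀), (c₁,cnt₁), …], r)` with the distinguished vertex FIRST (`cnt₀ ≥ 1`), checked against a two-level
table `MV2` of the vertex vectors (chunk width `w`: vertex `c` = `get2 MV2 (c / w, c % w)`), itself bridged once to the chart records
(`checkMVBridge`). SOUNDNESS `hcov_of_checkMulti`: the `hcov` binder of `CICertificates.ciCertificates` / `ReesCoverOfPowers` VERBATIM at
`A := genSet n AL2`, `m := chartM n AL2 CL t`. Definitions are computable list programs (no instances, no notation); no named facts. [folklore]
-/

-- single-problem summit: the doubled namespace component is forced
set_option linter.dupNamespace false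

namespace Summit.ResolutionOfSingularities.ResolutionOfSingularities.Theorems.FInjectiveMacaulayfication.FanCheckMulti

open Summit.ResolutionOfSingularities.ResolutionOfSingularities.Theorems.FInjectiveMacaulayfication
open FanCheckKit FanCheckSound MvPolynomial

/-! ## §1 The list programs -/

/-- The vertex vector of chart `c` from the two-level vertex table of chunk width `w`. [folklore] -/
def getMV (MV2 : List (List (List ℕ))) (w c : ℕ) : List ℕ := get2 MV2 (c / w, c % w)

/-- `Σ cnt` of a sparse record. [folklore] -/
def sumCnt : List (ℕ × ℕ) → ℕ
  | [] => 0
  | e :: es => e.2 + sumCnt es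

/-- `Σ cnt • m_c` of a sparse record, as a length-`n` list. [folklore] -/
def sumVerts (n : ℕ) (MV2 : List (List (List ℕ))) (w : ℕ) : List (ℕ × ℕ) → List ℕ
  | [] => List.replicate n 0
  | e :: es => addL (smulL e.2 (getMV MV2 w e.1)) (sumVerts n MV2 w es)

/-- (bridge) the vertex table agrees with the chart records: `MV[c] = AL2[vertex index of chart c]` for all `c < t`, all of length `n`. [folklore] -/
def checkMVBridge (n : ℕ) (AL2 MV2 : List (List (List ℕ))) (w t : ℕ)
    (CL : List (List ℕ × (ℕ × ℕ) × List (ℕ × ℕ) × List (List ℕ))) : Bool :=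
  (List.range t).all fun c => Nat.beq (getMV MV2 w c).length n && veqL (getMV MV2 w c) (get2 AL2 (chartRec CL c).2.1)

/-- (hcov, sparse multi-vertex records) record `(L, r)` at the position of generator `a`: `L = (c₀,cnt₀) :: …` non-empty with `cnt₀ ≥ 1`,
every `c < t`, `r` of length `n`, and `(Σ cnt) • a = Σ cnt • MV[c] + r`. [folklore] -/
def checkHcovMulti (n : ℕ) (AL2 MV2 : List (List (List ℕ))) (w t : ℕ) (RLM : List (List (ℕ × ℕ) × List ℕ)) : Bool :=
  Nat.beq AL2.flatten.length RLM.length && (AL2.flatten.zip RLM).all fun ar =>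
    (match ar.2.1 with
      | [] => false
      | e :: _ => Nat.ble 1 e.2) &&
    (ar.2.1.all fun e => Nat.blt e.1 t) && Nat.beq ar.2.2.length n &&
      veqL (smulL (sumCnt ar.2.1) ar.1) (addL (sumVerts n MV2 w ar.2.1) ar.2.2)

/-! ## §2 Soundness -/

variable {n : ℕ}

/-- Length of `sumVerts`. [folklore] -/
theorem length_sumVerts (MV2 : List (List (List ℕ))) (w : ℕ) :
    ∀ (L : List (ℕ × ℕ)), (∀ e ∈ L, (getMV MV2 w e.1).length = n) → (sumVerts n MV2 w L).length = n
  | [], _ => List.length_replicate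
  | e :: es, h => by
    rw [sumVerts, length_addL_eq_min, smulL, List.length_map, h e List.mem_cons_self,
      length_sumVerts MV2 w es fun e' he' => h e' (List.mem_cons_of_mem _ he'), min_self]

/-- `getL` of a replicate of zeros. [folklore] -/
theorem getL_replicate_zero : ∀ (m i : ℕ), getL (List.replicate m 0) i 0 = 0
  | 0, i => by rw [List.replicate_zero, getL_nil]
  | m + 1, 0 => by rw [List.replicate_succ, getL_cons_zero]
  | m + 1, i + 1 => by rw [List.replicate_succ, getL_cons_succ, getL_replicate_zero m i]

/-- Entries of `sumVerts`: `Σ cnt * MV[c]_j`. [folklore] -/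
theorem getL_sumVerts (MV2 : List (List (List ℕ))) (w : ℕ) :
    ∀ (L : List (ℕ × ℕ)), (∀ e ∈ L, (getMV MV2 w e.1).length = n) → ∀ j : ℕ,
      getL (sumVerts n MV2 w L) j 0 = (L.map fun e => e.2 * getL (getMV MV2 w e.1) j 0).sum
  | [], _, j => by rw [sumVerts, getL_replicate_zero, List.map_nil, List.sum_nil]
  | e :: es, h, j => by
    have hes : ∀ e' ∈ es, (getMV MV2 w e'.1).length = n := fun e' he' => h e' (List.mem_cons_of_mem _ he')
    rw [sumVerts, getL_addL _ _ (by rw [smulL, List.length_map, h e List.mem_cons_self, length_sumVerts MV2 w es hes]),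
      getL_smulL, getL_sumVerts MV2 w es hes j, List.map_cons, List.sum_cons]

/-- `sumCnt` is the sum of the counts. [folklore] -/
theorem sumCnt_eq : ∀ L : List (ℕ × ℕ), sumCnt L = (L.map Prod.snd).sum
  | [] => rfl
  | e :: es => by rw [sumCnt, sumCnt_eq es, List.map_cons, List.sum_cons]

/-- Products of powers of monic monomials over an indexed list. [folklore] -/
theorem prod_map_monomial_pow {k : Type} [CommSemiring k] (v : ℕ → (Fin n →₀ ℕ)) : ∀ (L : List (ℕ × ℕ)),
    (L.map fun e => (monomial (v e.1) (1 : k) : MvPolynomial (Fin n) k) ^ e.2).prod = monomial (L.map fun e => e.2 • v e.1).sum 1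
  | [] => by simp only [List.map_nil, List.prod_nil, List.sum_nil, monomial_zero', C_1]
  | e :: es => by
    simp only [List.map_cons, List.prod_cons, List.sum_cons]
    rw [prod_map_monomial_pow v es, monomial_pow, one_pow, monomial_mul, mul_one]

/-- A product of powers of elements of `I` (indexed list) lies in `I ^ (Σ exponents)`. [folklore] -/
theorem prod_map_pow_mem_pow {R : Type} [CommSemiring R] (I : Ideal R) (x : ℕ → R) : ∀ (L : List (ℕ × ℕ)), (∀ e ∈ L, x e.1 ∈ I) →
    (L.map fun e => x e.1 ^ e.2).prod ∈ I ^ (L.map Prod.snd).sum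
  | [], _ => by simp only [List.map_nil, List.prod_nil, List.sum_nil, pow_zero, Ideal.one_eq_top]; trivial
  | e :: es, h => by
    simp only [List.map_cons, List.prod_cons, List.sum_cons, pow_add]
    exact Ideal.mul_mem_mul (Ideal.pow_mem_pow (h e List.mem_cons_self) _)
      (prod_map_pow_mem_pow I x es fun e' he' => h e' (List.mem_cons_of_mem _ he'))

/-- **THE SPARSE MULTI-VERTEX COVER RECORD** (list form of `MonomialCoverMultiRecord.monomialCoverMultiRecord`): vertices `v c₀, v c_i`
with `x^{v c₀}, x^{v c_i} ∈ I_A`, `cnt₀ ≥ 1`, `(cnt₀ + Σ cnt_i) • a = cnt₀ • v c₀ + Σ cnt_i • v c_i + r` ⟹ `(x^a)^K = x^{v c₀} · y` with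
`y ∈ I_A^(K-1)`, `K = cnt₀ + Σ cnt_i`. [folklore] -/
theorem monomialCoverSparseRecord (k : Type) [CommSemiring k] (A : Finset (Fin n →₀ ℕ)) (v : ℕ → (Fin n →₀ ℕ)) (a : Fin n →₀ ℕ)
    (c₀ cnt₀ : ℕ) (hc₀ : 1 ≤ cnt₀) (L : List (ℕ × ℕ)) (r : Fin n →₀ ℕ)
    (hv₀ : (monomial (v c₀) (1 : k) : MvPolynomial (Fin n) k) ∈
      Ideal.span ((fun b : Fin n →₀ ℕ => (monomial b (1 : k) : MvPolynomial (Fin n) k)) '' (A : Set (Fin n →₀ ℕ))))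
    (hL : ∀ e ∈ L, (monomial (v e.1) (1 : k) : MvPolynomial (Fin n) k) ∈
      Ideal.span ((fun b : Fin n →₀ ℕ => (monomial b (1 : k) : MvPolynomial (Fin n) k)) '' (A : Set (Fin n →₀ ℕ))))
    (hrec : (cnt₀ + (L.map Prod.snd).sum) • a = cnt₀ • v c₀ + (L.map fun e => e.2 • v e.1).sum + r) :
    ∃ (K : ℕ), 1 ≤ K ∧ ∃ y ∈ (Ideal.span ((fun b : Fin n →₀ ℕ => (monomial b (1 : k) : MvPolynomial (Fin n) k)) ''
        (A : Set (Fin n →₀ ℕ)))) ^ (K - 1), (monomial a (1 : k) : MvPolynomial (Fin n) k) ^ K = monomial (v c₀) 1 * y := by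
  set I := Ideal.span ((fun b : Fin n →₀ ℕ => (monomial b (1 : k) : MvPolynomial (Fin n) k)) '' (A : Set (Fin n →₀ ℕ))) with hI
  refine ⟨cnt₀ + (L.map Prod.snd).sum, le_trans hc₀ (Nat.le_add_right _ _),
    (monomial (v c₀) (1 : k)) ^ (cnt₀ - 1) * (L.map fun e => (monomial (v e.1) (1 : k) : MvPolynomial (Fin n) k) ^ e.2).prod * monomial r 1,
    ?_, ?_⟩
  · have hK : cnt₀ + (L.map Prod.snd).sum - 1 = (cnt₀ - 1) + (L.map Prod.snd).sum := by omega
    rw [hK, pow_add]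
    exact Ideal.mul_mem_right _ _ (Ideal.mul_mem_mul (Ideal.pow_mem_pow hv₀ _)
      (prod_map_pow_mem_pow I (fun c => (monomial (v c) (1 : k) : MvPolynomial (Fin n) k)) L hL))
  · rw [prod_map_monomial_pow, monomial_pow, one_pow, hrec, monomial_pow, one_pow, monomial_mul, monomial_mul, monomial_mul,
      mul_one, mul_one, mul_one]
    congr 1
    have h1 : cnt₀ • v c₀ = v c₀ + (cnt₀ - 1) • v c₀ := by
      conv_lhs => rw [show cnt₀ = 1 + (cnt₀ - 1) by omega]
      rw [add_smul, one_smul]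
    rw [h1]
    abel

/-- Applying a list sum of exponents at a coordinate. [folklore] -/
theorem list_sum_apply (j : Fin n) : ∀ (l : List (Fin n →₀ ℕ)), l.sum j = (l.map fun f => f j).sum
  | [] => by simp
  | f :: fs => by rw [List.sum_cons, List.map_cons, List.sum_cons, Finsupp.add_apply, list_sum_apply j fs]

/-- `getMV` vectors are vertices: under the bridge, `expOf n (getMV MV2 w c) = chartM n AL2 CL t c`. [folklore] -/
theorem expOf_getMV (AL2 MV2 : List (List (List ℕ))) (w t : ℕ) (CL : List (List ℕ × (ℕ × ℕ) × List (ℕ × ℕ) × List (List ℕ)))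
    (hb : checkMVBridge n AL2 MV2 w t CL = true) (c : Fin t) :
    (getMV MV2 w c.1).length = n ∧ expOf n (getMV MV2 w c.1) = chartM n AL2 CL t c := by
  simp only [checkMVBridge, List.all_eq_true, List.mem_range, Bool.and_eq_true, Nat.beq_eq] at hb
  obtain ⟨hlen, hv⟩ := hb c.1 c.2
  exact ⟨hlen, by rw [chartM, eq_of_veqL _ _ hv]⟩

/-- The exponent identity of a checked sparse record, in `Finsupp` currency. [folklore] -/
theorem record_identity (MV2 : List (List (List ℕ))) (w : ℕ) (al r' : List ℕ) (L : List (ℕ × ℕ))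
    (hmvlen : ∀ e ∈ L, (getMV MV2 w e.1).length = n) (hrlen : r'.length = n)
    (hEq : smulL (sumCnt L) al = addL (sumVerts n MV2 w L) r') :
    (L.map Prod.snd).sum • expOf n al = (L.map fun e => e.2 • expOf n (getMV MV2 w e.1)).sum + expOf n r' := by
  ext j
  have hj : getL (smulL (sumCnt L) al) j.1 0 = getL (addL (sumVerts n MV2 w L) r') j.1 0 := by rw [hEq]
  rw [getL_smulL, getL_addL _ _ (by rw [length_sumVerts MV2 w _ hmvlen, hrlen]), getL_sumVerts MV2 w _ hmvlen, sumCnt_eq] at hj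
  rw [Finsupp.smul_apply, Finsupp.add_apply, list_sum_apply, List.map_map, smul_eq_mul, coe_expOf, coe_expOf]
  have hmap : (L.map ((fun f : Fin n →₀ ℕ => f j) ∘ fun e : ℕ × ℕ => e.2 • expOf n (getMV MV2 w e.1))) =
      L.map fun e => e.2 * getL (getMV MV2 w e.1) j.1 0 := by
    refine List.map_congr_left fun e _ => ?_
    rw [Function.comp_apply, Finsupp.smul_apply, smul_eq_mul, coe_expOf]
    rfl
  rw [hmap]
  exact hj

/-- One checked sparse record, unpacked: from the Boolean facts of `checkHcovMulti` at a generator vector `al` with record `((c₀,cnt₀) :: L', r')`,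
the `hcov` witness. [folklore] -/
theorem hcov_of_record (k : Type) [CommSemiring k] {r : ℕ} (AL2 MV2 : List (List (List ℕ))) (RAYS : List (List ℕ))
    (CL : List (List ℕ × (ℕ × ℕ) × List (ℕ × ℕ) × List (List ℕ))) (w t : ℕ)
    (hsh : checkShapes n r AL2 RAYS CL = true) (ht : CL.length = t) (hb : checkMVBridge n AL2 MV2 w t CL = true)
    (al : List ℕ) (c₀ cnt₀ : ℕ) (L' : List (ℕ × ℕ)) (r' : List ℕ)
    (hhead : 1 ≤ cnt₀) (hlt : ∀ e ∈ ((c₀, cnt₀) :: L'), e.1 < t) (hrlen : r'.length = n)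
    (hEq : smulL (sumCnt ((c₀, cnt₀) :: L')) al = addL (sumVerts n MV2 w ((c₀, cnt₀) :: L')) r') :
    ∃ (c : Fin t) (K : ℕ), 1 ≤ K ∧
      ∃ y ∈ (Ideal.span ((fun b : Fin n →₀ ℕ => (monomial b (1 : k) : MvPolynomial (Fin n) k)) ''
          (genSet n AL2 : Set (Fin n →₀ ℕ)))) ^ (K - 1),
        (monomial (expOf n al) (1 : k) : MvPolynomial (Fin n) k) ^ K = monomial (chartM n AL2 CL t c) 1 * y := by
  have hc₀ : c₀ < t := hlt (c₀, cnt₀) List.mem_cons_self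
  have hmvlen : ∀ e ∈ ((c₀, cnt₀) :: L'), (getMV MV2 w e.1).length = n :=
    fun e he => (expOf_getMV AL2 MV2 w t CL hb ⟨e.1, hlt e he⟩).1
  -- vertices are generators, hence their monomials lie in `I_A`
  have hvgen : ∀ c : ℕ, c < t → (monomial (expOf n (getMV MV2 w c)) (1 : k) : MvPolynomial (Fin n) k) ∈
      Ideal.span ((fun b : Fin n →₀ ℕ => (monomial b (1 : k) : MvPolynomial (Fin n) k)) '' (genSet n AL2 : Set (Fin n →₀ ℕ))) := by
    intro c hc
    rw [(expOf_getMV AL2 MV2 w t CL hb ⟨c, hc⟩).2]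
    exact Ideal.subset_span ⟨_, Finset.mem_coe.mpr (hm_of_shapes n r AL2 RAYS CL t hsh ht _), rfl⟩
  have hv0 : (monomial ((fun c : ℕ => expOf n (getMV MV2 w c)) c₀) (1 : k) : MvPolynomial (Fin n) k) ∈
      Ideal.span ((fun b : Fin n →₀ ℕ => (monomial b (1 : k) : MvPolynomial (Fin n) k)) '' (genSet n AL2 : Set (Fin n →₀ ℕ))) :=
    hvgen c₀ hc₀
  have hvL : ∀ e ∈ L', (monomial ((fun c : ℕ => expOf n (getMV MV2 w c)) e.1) (1 : k) : MvPolynomial (Fin n) k) ∈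
      Ideal.span ((fun b : Fin n →₀ ℕ => (monomial b (1 : k) : MvPolynomial (Fin n) k)) '' (genSet n AL2 : Set (Fin n →₀ ℕ))) :=
    fun e he => hvgen e.1 (hlt e (List.mem_cons_of_mem _ he))
  have hid := record_identity MV2 w al r' ((c₀, cnt₀) :: L') hmvlen hrlen hEq
  rw [List.map_cons, List.sum_cons, List.map_cons, List.sum_cons] at hid
  obtain ⟨K, hK, y, hy, hEqK⟩ := monomialCoverSparseRecord k (genSet n AL2) (fun c => expOf n (getMV MV2 w c)) (expOf n al) c₀ cnt₀
    hhead L' (expOf n r') hv0 hvL hid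
  refine ⟨⟨c₀, hc₀⟩, K, hK, y, hy, ?_⟩
  rw [← (expOf_getMV AL2 MV2 w t CL hb ⟨c₀, hc₀⟩).2]
  exact hEqK

/-- **(hcov) FROM SPARSE MULTI-VERTEX RECORDS**: the cover identities `(x^a)^K = x^(m c) · y`, `y ∈ I_A^(K-1)`, for every generator, in the
binder shape of `CICertificates.ciCertificates` / `FanCheckSound.hcov_of_check`. [folklore] -/
theorem hcov_of_checkMulti (k : Type) [CommSemiring k] {r : ℕ} (AL2 MV2 : List (List (List ℕ))) (RAYS : List (List ℕ))
    (CL : List (List ℕ × (ℕ × ℕ) × List (ℕ × ℕ) × List (List ℕ))) (w t : ℕ) (RLM : List (List (ℕ × ℕ) × List ℕ))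
    (hsh : checkShapes n r AL2 RAYS CL = true) (ht : CL.length = t) (hb : checkMVBridge n AL2 MV2 w t CL = true)
    (h : checkHcovMulti n AL2 MV2 w t RLM = true) :
    ∀ a ∈ genSet n AL2, ∃ (c : Fin t) (K : ℕ), 1 ≤ K ∧
      ∃ y ∈ (Ideal.span ((fun b : Fin n →₀ ℕ => (monomial b (1 : k) : MvPolynomial (Fin n) k)) ''
          (genSet n AL2 : Set (Fin n →₀ ℕ)))) ^ (K - 1),
        (monomial a (1 : k) : MvPolynomial (Fin n) k) ^ K = monomial (chartM n AL2 CL t c) 1 * y := by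
  intro a ha
  obtain ⟨al, hal, rfl⟩ := exists_of_mem_genSet ha
  obtain ⟨p, hp, hpal⟩ := exists_getL_eq_of_mem AL2.flatten [] hal
  simp only [checkHcovMulti, Bool.and_eq_true, Nat.beq_eq, List.all_eq_true] at h
  obtain ⟨hlenRL, hall⟩ := h
  have hmem := mk_getL_mem_zip AL2.flatten RLM [] ([], []) p hp (by rw [← hlenRL]; exact hp)
  rw [hpal] at hmem
  have hrec := hall _ hmem
  rcases hrc : getL RLM p ([], []) with ⟨_ | ⟨⟨c₀, cnt₀⟩, L'⟩, r'⟩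
  · rw [hrc] at hrec
    simp at hrec
  · rw [hrc] at hrec
    simp only [Nat.ble_eq, Nat.blt_eq] at hrec
    obtain ⟨⟨⟨hhead, hlt⟩, hrlen⟩, hveq⟩ := hrec
    exact hcov_of_record k AL2 MV2 RAYS CL w t hsh ht hb al c₀ cnt₀ L' r' hhead hlt hrlen (eq_of_veqL _ _ hveq)

end Summit.ResolutionOfSingularities.ResolutionOfSingularities.Theorems.FInjectiveMacaulayfication.FanCheckMulti
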